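import Literature.LinearAlgebra.Matrix.LogFrechetDerivative
import Literature.InformationTheory.Entropy.VonNeumannEntropyInequalities
import Literature.InformationTheory.Entropy.RelativeEntropyMonotonicityDensity
import Literature.InformationTheory.Entropy.WeakMonotonicityFromRelEntropy
import Literature.InformationTheory.Entropy.ConditionalEntropyConcavity
import Literature.MathematicalPhysics.QuantumLattice.GibbsVariationalPrinciple
import Literature.MathematicalPhysics.QuantumLattice.ConditionalFreeEnergyCertificate
import HarnessLib

/-!
# Lieb's concavity theorem `A ↦ Tr exp(K + log A)`, Lieb's triple-matrix inequality, and the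
# Lieb-constant certificate for the conditional free energy

Topic `MathematicalPhysics/QuantumLattice`, namespace `Literature.MathematicalPhysics.QuantumLattice`.
Finite-dimensional (complex matrices); `log`, `exp` are Mathlib's continuous functional calculus
`cfc Real.log`, `cfc Real.exp`; the Fréchet derivative of `log` at `B₀ = V diag(μ) V⋆` is the tree's
`Literature.LinearAlgebra.Matrix.logFrechet V μ` (`LogFrechetDerivative.lean`; Lieb's `T_{B₀}`).

* `quantumRelEntropy_convex_combination_le` — JOINT CONVEXITY of the relative-entropy functional
  `D(X‖B) = Re Tr X(log X − log B)` on segments of positive definite pairs (Lindblad 1974; Tropp 2012,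
  Fact 4), PROVED from the tree's monotonicity under the partial trace
  (`re_trace_traceRight_mul_log_sub_log_le`, Lindblad 1975) applied to the block-diagonal
  (classical–quantum) embedding `X₀ ⊕ X₁`, whose partial trace over the block label is `X₀ + X₁`.
  [cite: Lindblad1974, Theorem 1] [cite: Tropp2012, Fact 4]
* `trace_sub_trace_le_quantumRelEntropy` — KLEIN's inequality, unnormalised form
  `Tr X − Tr Y ≤ Re Tr X(log X − log Y)` (Tropp 2012, Fact 3; i.e. `D(X;Y) ≥ 0`), PROVED from the tree's
  Gibbs variational principle. [cite: Tropp2012, Fact 3]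
* **`re_trace_exp_le_of_log_tangent`** / **`lieb_triple_matrix_inequality'`** — Lieb's Theorem 7
  in supergradient form: for positive definite `X₀, B₀ = V diag(μ) V⋆, B`,
  `Tr exp(log X₀ − log B₀ + log B) ≤ Re Tr(X₀ · dlog_{B₀}[B])`, i.e. (Lieb's letters
  `X₀ = e^C`, `B₀ = e^{−A}`, `B = e^B`) `Tr e^{A+B+C} ≤ Tr e^C T_{e^{−A}}(e^B)`
  (`lieb_triple_matrix_inequality`). PROOF (Tropp's route, made derivative-free): with
  `X = exp(log X₀ − log B₀ + log B)` and the segment `(X_t, B_t) = (1−t)(X₀,B₀) + t(X,B)`, joint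
  convexity bounds `D(X_t‖B_t)` above by `(1−t)D(X₀‖B₀) + tD(X‖B)`, while Klein (`D(X_t‖X₀) ≥ Tr X_t − Tr X₀`)
  and the tangent inequality `log B_t ≤ log B₀ + t·dlog_{B₀}[B − B₀]` bound it below by the SAME
  quantity plus `Tr X_t − Tr X₀ − t Re Tr(X_t dlog[B − B₀])`; dividing by `t` and letting `t → 0⁺`
  (the bound is affine in `t`) gives `Tr X ≤ Tr X₀ + Re Tr(X₀ dlog[B − B₀]) = Re Tr(X₀ dlog[B])`.
  [cite: Lieb1973ConvexTrace, Theorem 7 and Lemma 5] [cite: Petz2008, Theorem 11.29] [cite: Tropp2012, Lemma 6 and §3]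
* **`lieb_concavity`** — LIEB'S CONCAVITY THEOREM (Lieb 1973, Theorem 6; Tropp 2012, Theorem 1): for
  Hermitian `K`, `A ↦ Tr exp(K + log A)` is concave on positive definite matrices:
  `(1−t) F(A₀) + t F(A₁) ≤ F((1−t)A₀ + tA₁)` — from the supergradient form at `A_t` and
  `dlog_{A_t}[A_t] = 1` (Lieb's Lemma 5 read backwards). [cite: Lieb1973ConvexTrace, Theorem 6]
  [cite: Tropp2012, Theorem 1]
* **`vonNeumannEntropy_sub_traceLeft_sub_le_of_liebCertificate`** and
  **`condEntropy_le_of_liebCertificate`** — the LIEB-CONSTANT CERTIFICATE for the conditional free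
  energy on `ℋ_A ⊗ ℋ_B` (the companion of the tree's Lindblad-tangent certificate
  `vonNeumannEntropy_sub_traceLeft_sub_le_of_certificate`): for every density matrix `ρ`, Hermitian
  `H`, positive definite `σ₀ = V diag(μ) V⋆`, and any `Z⁺ ≥ Tr_A exp(−H + 𝟙 ⊗ log σ₀)`,
  `e^c · 1 ≥ dlog_{σ₀}[Z⁺]` implies `S(ρ) − S(Tr_A ρ) − Re tr(ρH) ≤ c`; with `H = G − 𝟙 ⊗ G_W`,
  `σ₀ = e^{−G_W}` this is `S(ρ_{AB}) − S(ρ_B) ≤ Re tr(ρ G) − Re tr(ρ_B G_W) + c` whenever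
  `e^c ≥ λ_max(Q(L ∘ QᵀZ⁺Q)Qᵀ)` — the sharper ("Lieb") constant of the conditional-entropy rows of
  entropy-constrained thermal relaxations, justified by Lieb concavity + homogeneity
  (`Φ(σ) ≤ dΦ(σ₀)[σ]`). Proof: Gibbs variational principle at `H' = H − 𝟙 ⊗ log(ρ_B + ε)`,
  `Tr ρ_B log ρ_B ≤ Tr ρ_B log(ρ_B + ε)`, Lieb's supergradient inequality on `ℋ_A ⊗ ℋ_B` with the
  tangent `𝟙 ⊗ dlog_{σ₀}[·]`, trace-self-adjointness and monotonicity of `dlog`, `ε → 0⁺`.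
  [cite: Lieb1973ConvexTrace, Theorems 6–7] [cite: PoulinHastings2011, eqs. (4)–(8)]

Everything is PROVED (no named fact, no new definition).

## References

* E. H. Lieb, *Convex trace functions and the Wigner–Yanase–Dyson conjecture*, Adv. Math. 11 (1973)
  267–288: Lemma 5, Theorem 6 (p. 280), Theorem 7 (p. 282), §5 remark (b) (p. 287). [Lieb1973ConvexTrace]
* J. A. Tropp, *From joint convexity of quantum relative entropy to a concavity theorem of Lieb*,
  Proc. AMS 140 (2012) 1757–1760: Theorem 1, Facts 3–4, Proposition 5, Lemma 6. [Tropp2012]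
* G. Lindblad, *Expectations and entropy inequalities for finite quantum systems*, Commun. Math. Phys.
  39 (1974) 111–119 (joint convexity of the relative entropy). [Lindblad1974]
* D. Petz, *Quantum Information Theory and Quantum Statistics* (Springer 2008), Theorem 11.29
  (Lieb's extension of Golden–Thompson). [Petz2008]
* D. Poulin, M. B. Hastings, Phys. Rev. Lett. 106 (2011) 080403, eqs. (4)–(8) (conditional-entropy /
  Markov free-energy duals). [PoulinHastings2011]

## Mathlib / tree

Tree: `re_trace_traceRight_mul_log_sub_log_le` (Lindblad, PD case), `quantumRelEntropy`,
`vonNeumannEntropy`, `re_trace_mul_cfc_log`, `Matrix.IsHermitian.vonNeumannEntropy_sub_mul_le_log_partitionFn`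
(Gibbs variational principle), `posSemidef_blockDiagonal`, `cfc_eq_conj_diagonal`, `cfc_diagonal_kronecker`,
`trace_mul_one_kronecker`, `posDef_traceLeft`, `posSemidef_traceLeft`, `posDef_cfc_exp`, `cfc_log_cfc_exp`,
`cfc_log_smul_of_posDef`, `re_trace_mul_nonneg_of_posSemidef`, and `LogFrechetDerivative.lean`
(`logFrechet`, `posSemidef_log_add_logFrechet_sub_log`, `logFrechet_self`, `trace_mul_logFrechet_comm`,
`logFrechet_mono`).
-/

noncomputable section

open Matrix Filter
open scoped Topology ComplexOrder MatrixOrder Kronecker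

namespace Literature.MathematicalPhysics.QuantumLattice

open Literature.Computability.QuantumComplexity (traceLeft traceRight traceLeft_apply traceRight_apply
  trace_traceLeft)
open Literature.InformationTheory.Entropy (vonNeumannEntropy quantumRelEntropy re_trace_mul_cfc_log
  posSemidef_blockDiagonal isHermitian_blockDiagonal re_trace_traceRight_mul_log_sub_log_le posDef_traceLeft
  trace_mul_one_kronecker isHermitian_traceLeft cfc_diagonal_kronecker)
open Literature.LinearAlgebra.Matrix (re_trace_mul_nonneg_of_posSemidef cfc_eq_conj_diagonal
  isHermitian_conj_diagonal trace_unitary_conj logFrechet logFrechet_add logFrechet_sub logFrechet_smul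
  logFrechet_self trace_mul_logFrechet_comm posSemidef_log_add_logFrechet_sub_log logFrechet_mono
  isHermitian_logFrechet)

/-! ### Joint convexity of the relative entropy on positive definite segments (Lindblad 1974) -/

section JointConvexity

variable {d : Type} [Fintype d] [DecidableEq d]

omit [DecidableEq d] in
/-- Trace of a block-diagonal matrix: `Tr (⊕ₖ Mₖ) = Σₖ Tr Mₖ`. [folklore] -/
private theorem trace_blockDiagonal {o : Type} [Fintype o] [DecidableEq o] (M : o → Matrix d d ℂ) :
    (blockDiagonal M).trace = ∑ k, (M k).trace := by
  simp only [Matrix.trace, Matrix.diag, Fintype.sum_prod_type, blockDiagonal_apply_eq]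
  rw [Finset.sum_comm]

omit [Fintype d] [DecidableEq d] in
/-- The partial trace over the block label of a block-diagonal matrix is the sum of the blocks:
`Tr_o (⊕ₖ Mₖ) = Σₖ Mₖ` (blocks indexed by the SECOND factor, `traceRight`). [folklore] -/
private theorem traceRight_blockDiagonal {o : Type} [Fintype o] [DecidableEq o] (M : o → Matrix d d ℂ) :
    traceRight (blockDiagonal M) = ∑ k, M k := by
  ext a b
  simp only [traceRight_apply, blockDiagonal_apply_eq, Matrix.sum_apply]

/-- A block-diagonal matrix with positive definite blocks is positive definite. [folklore] -/
private theorem posDef_blockDiagonal {o : Type} [Fintype o] [DecidableEq o] {M : o → Matrix d d ℂ}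
    (hM : ∀ k, (M k).PosDef) : (blockDiagonal M).PosDef := by
  refine (posSemidef_blockDiagonal fun k => (hM k).posSemidef).posDef_iff_isUnit.mpr ?_
  rw [Matrix.isUnit_iff_isUnit_det, det_blockDiagonal]
  exact IsUnit.mk0 _ (Finset.prod_ne_zero_iff.mpr fun k _ => (Matrix.isUnit_iff_isUnit_det _ |>.mp (hM k).isUnit).ne_zero)

/-- The functional calculus of a block-diagonal matrix with Hermitian blocks acts blockwise:
`f(⊕ₖ Mₖ) = ⊕ₖ f(Mₖ)` (diagonalise each block; `⊕ₖ Vₖ` diagonalises the sum). [folklore] -/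
private theorem cfc_blockDiagonal {o : Type} [Fintype o] [DecidableEq o] {M : o → Matrix d d ℂ}
    (hM : ∀ k, (M k).IsHermitian) (f : ℝ → ℝ) :
    cfc f (blockDiagonal M) = blockDiagonal fun k => cfc f (M k) := by
  -- eigendata of the blocks
  set W : o → Matrix d d ℂ := fun k => ((hM k).eigenvectorUnitary : Matrix d d ℂ) with hW
  have hWu : ∀ k, W k ∈ Matrix.unitaryGroup d ℂ := fun k => (hM k).eigenvectorUnitary.2
  have hMW : ∀ k, M k = W k * diagonal (fun j => (((hM k).eigenvalues j : ℝ) : ℂ)) * star (W k) :=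
    fun k => (hM k).spectral_theorem
  have hs : star (blockDiagonal W) = blockDiagonal fun k => star (W k) := by
    rw [Matrix.star_eq_conjTranspose, blockDiagonal_conjTranspose]; rfl
  -- the block unitary
  have hBu : blockDiagonal W ∈ Matrix.unitaryGroup (d × o) ℂ := by
    rw [Matrix.mem_unitaryGroup_iff, hs, ← blockDiagonal_mul, ← blockDiagonal_one]
    congr 1
    funext k
    exact Matrix.mem_unitaryGroup_iff.mp (hWu k)
  have hBD : blockDiagonal M = blockDiagonal W *
      diagonal (fun jk : d × o => (((hM jk.2).eigenvalues jk.1 : ℝ) : ℂ)) * star (blockDiagonal W) := by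
    rw [hs, ← blockDiagonal_diagonal (fun k j => (((hM k).eigenvalues j : ℝ) : ℂ)), ← blockDiagonal_mul,
      ← blockDiagonal_mul]
    congr 1
    funext k
    exact hMW k
  have h1 : cfc f (blockDiagonal M) = blockDiagonal W *
      diagonal (fun jk : d × o => ((f ((hM jk.2).eigenvalues jk.1) : ℝ) : ℂ)) * star (blockDiagonal W) :=
    cfc_eq_conj_diagonal hBu hBD f
  have h2 : ∀ k, cfc f (M k) = W k * diagonal (fun j => ((f ((hM k).eigenvalues j) : ℝ) : ℂ)) * star (W k) :=
    fun k => cfc_eq_conj_diagonal (hWu k) (hMW k) f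
  rw [h1, hs, ← blockDiagonal_diagonal (fun k j => ((f ((hM k).eigenvalues j) : ℝ) : ℂ)), ← blockDiagonal_mul,
    ← blockDiagonal_mul]
  congr 1
  funext k
  exact (h2 k).symm

/-- The relative-entropy functional of a block-diagonal pair splits over the blocks:
`D(⊕Xₖ ‖ ⊕Bₖ) = Σₖ D(Xₖ‖Bₖ)`. [cite: Tropp2012, Fact 4 (proof via Lindblad)] -/
private theorem quantumRelEntropy_blockDiagonal {o : Type} [Fintype o] [DecidableEq o]
    {X B : o → Matrix d d ℂ} (hX : ∀ k, (X k).IsHermitian) (hB : ∀ k, (B k).IsHermitian) :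
    quantumRelEntropy (blockDiagonal X) (blockDiagonal B) = ∑ k, quantumRelEntropy (X k) (B k) := by
  unfold quantumRelEntropy
  rw [cfc_blockDiagonal hX, cfc_blockDiagonal hB, ← blockDiagonal_sub, ← blockDiagonal_mul,
    trace_blockDiagonal, Complex.re_sum]
  simp only [Pi.sub_apply]

/-- `D(cX ‖ cB) = c · D(X‖B)` for `c > 0` and positive definite `X, B` (`log(cX) − log(cB) = log X − log B`).
[cite: Tropp2012, Fact 4 (proof)] -/
private theorem quantumRelEntropy_smul {X B : Matrix d d ℂ} (hX : X.PosDef) (hB : B.PosDef) {c : ℝ}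
    (hc : 0 < c) :
    quantumRelEntropy ((c : ℂ) • X) ((c : ℂ) • B) = c * quantumRelEntropy X B := by
  unfold quantumRelEntropy
  rw [cfc_log_smul_of_posDef hX hc, cfc_log_smul_of_posDef hB hc, add_sub_add_left_eq_sub,
    Matrix.smul_mul, Matrix.trace_smul, smul_eq_mul, Complex.re_ofReal_mul]

/-- **Joint convexity of the quantum relative entropy** (Lindblad 1974; Tropp 2012, Fact 4) on a
segment of positive definite pairs: for positive definite `X₀, X₁, B₀, B₁` and `0 < t < 1`,
`D((1−t)X₀ + tX₁ ‖ (1−t)B₀ + tB₁) ≤ (1−t) D(X₀‖B₀) + t D(X₁‖B₁)`, `D(X‖B) = Re Tr X(log X − log B)`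
(the tree's `quantumRelEntropy`). Proof: Lindblad's monotonicity under the partial trace (tree,
`re_trace_traceRight_mul_log_sub_log_le`) for the block-diagonal pair `((1−t)X₀ ⊕ tX₁, (1−t)B₀ ⊕ tB₁)`,
whose partial trace over the block label is the pair of convex combinations.
[cite: Lindblad1974, Theorem 1] [cite: Tropp2012, Fact 4] -/
theorem quantumRelEntropy_convex_combination_le {X₀ X₁ B₀ B₁ : Matrix d d ℂ} (hX₀ : X₀.PosDef)
    (hX₁ : X₁.PosDef) (hB₀ : B₀.PosDef) (hB₁ : B₁.PosDef) {t : ℝ} (ht0 : 0 < t) (ht1 : t < 1) :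
    quantumRelEntropy ((((1 - t : ℝ) : ℂ)) • X₀ + ((t : ℝ) : ℂ) • X₁)
        ((((1 - t : ℝ) : ℂ)) • B₀ + ((t : ℝ) : ℂ) • B₁) ≤
      (1 - t) * quantumRelEntropy X₀ B₀ + t * quantumRelEntropy X₁ B₁ := by
  have h1t : 0 < 1 - t := by linarith
  -- the two block families, indexed by `Bool`
  set X : Bool → Matrix d d ℂ := fun b => cond b ((((1 - t : ℝ) : ℂ)) • X₀) (((t : ℝ) : ℂ) • X₁) with hXd
  set B : Bool → Matrix d d ℂ := fun b => cond b ((((1 - t : ℝ) : ℂ)) • B₀) (((t : ℝ) : ℂ) • B₁) with hBd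
  have hXpd : ∀ b, (X b).PosDef := by
    intro b; cases b
    · exact hX₁.smul (by exact_mod_cast ht0)
    · exact hX₀.smul (by exact_mod_cast h1t)
  have hBpd : ∀ b, (B b).PosDef := by
    intro b; cases b
    · exact hB₁.smul (by exact_mod_cast ht0)
    · exact hB₀.smul (by exact_mod_cast h1t)
  have hL := re_trace_traceRight_mul_log_sub_log_le (posDef_blockDiagonal hXpd) (posDef_blockDiagonal hBpd)
  rw [traceRight_blockDiagonal, traceRight_blockDiagonal] at hL
  have hsumX : ∑ b, X b = (((1 - t : ℝ) : ℂ)) • X₀ + ((t : ℝ) : ℂ) • X₁ := by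
    rw [Fintype.sum_bool]; rfl
  have hsumB : ∑ b, B b = (((1 - t : ℝ) : ℂ)) • B₀ + ((t : ℝ) : ℂ) • B₁ := by
    rw [Fintype.sum_bool]; rfl
  rw [hsumX, hsumB] at hL
  have hsplit := quantumRelEntropy_blockDiagonal (fun b => (hXpd b).1) (fun b => (hBpd b).1)
  unfold quantumRelEntropy at hsplit
  rw [hsplit, Fintype.sum_bool] at hL
  have e0 : quantumRelEntropy (X true) (B true) = (1 - t) * quantumRelEntropy X₀ B₀ :=
    quantumRelEntropy_smul hX₀ hB₀ h1t
  have e1 : quantumRelEntropy (X false) (B false) = t * quantumRelEntropy X₁ B₁ :=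
    quantumRelEntropy_smul hX₁ hB₁ ht0
  unfold quantumRelEntropy at e0 e1 ⊢
  linarith

end JointConvexity

/-! ### Klein's inequality, unnormalised form (Tropp 2012, Fact 3) -/

section Klein

variable {d : Type} [Fintype d] [DecidableEq d]

/-- `exp (log Y) = Y` for positive definite `Y` (functional calculus). [cite: Petz2008, §11.6] -/
theorem cfc_exp_cfc_log {Y : Matrix d d ℂ} (hY : Y.PosDef) : cfc Real.exp (cfc Real.log Y) = Y := by
  open scoped Matrix.Norms.L2Operator in
  exact by
    letI : CStarAlgebra (Matrix d d ℂ) := {}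
    have h := CFC.exp_log (A := Matrix d d ℂ) Y hY.isStrictlyPositive
    rwa [CFC.log, ← CFC.real_exp_eq_normedSpace_exp] at h

/-- The tree's partition function at `β = 1` is the trace of `cfc exp (−H)`. [folklore] -/
private theorem partitionFn_one_eq {H : Matrix d d ℂ} (hH : H.IsHermitian) :
    partitionFn 1 H = (cfc Real.exp (-H)).trace := by
  open scoped Matrix.Norms.L2Operator in
  exact by
    rw [partitionFn, gibbsWeight, Complex.ofReal_one, neg_one_smul,
      ← CFC.real_exp_eq_normedSpace_exp (ha := hH.neg.isSelfAdjoint)]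

/-- **Klein's inequality, unnormalised** (Tropp 2012, Fact 3 with Definition 2:
`D(X; Y) = Tr(X log X − X log Y − (X − Y)) ≥ 0`): for positive definite `X, Y`,
`Re Tr X − Re Tr Y ≤ Re Tr X(log X − log Y)`. Proof: the Gibbs variational principle (tree) for the
state `X / Tr X` and the "Hamiltonian" `−log Y` gives `Re Tr X(log X − log Y) ≥ Tr X · log(Tr X / Tr Y)`,
and `a log(a/b) ≥ a − b`. [cite: Tropp2012, Fact 3] -/
theorem trace_sub_trace_le_quantumRelEntropy {X Y : Matrix d d ℂ} (hX : X.PosDef) (hY : Y.PosDef) :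
    X.trace.re - Y.trace.re ≤ quantumRelEntropy X Y := by
  rcases isEmpty_or_nonempty d with hd | hd
  · simp [quantumRelEntropy, Matrix.trace]
  -- normalise `X`
  set tX : ℝ := X.trace.re with htX
  set tY : ℝ := Y.trace.re with htY
  have htXpos : 0 < tX := by
    have h := hX.trace_pos; rw [Complex.lt_def] at h; simpa using h.1
  have htYpos : 0 < tY := by
    have h := hY.trace_pos; rw [Complex.lt_def] at h; simpa using h.1
  have hXtr : X.trace = (tX : ℂ) := by
    apply Complex.ext
    · simp [htX]
    · rw [Complex.ofReal_im]; exact Literature.LinearAlgebra.Matrix.trace_im_of_posSemidef hX.posSemidef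
  have hYtr : Y.trace = (tY : ℂ) := by
    apply Complex.ext
    · simp [htY]
    · rw [Complex.ofReal_im]; exact Literature.LinearAlgebra.Matrix.trace_im_of_posSemidef hY.posSemidef
  set ρ : Matrix d d ℂ := ((tX⁻¹ : ℝ) : ℂ) • X with hρ
  have hρpsd : ρ.PosSemidef := hX.posSemidef.smul (by exact_mod_cast (inv_pos.mpr htXpos).le)
  have hρtr : ρ.trace = 1 := by
    rw [hρ, Matrix.trace_smul, hXtr, smul_eq_mul, ← Complex.ofReal_mul, inv_mul_cancel₀ htXpos.ne',
      Complex.ofReal_one]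
  -- Gibbs variational principle with `H := −log Y`, `β = 1`
  have hlogY : (cfc Real.log Y).IsHermitian := (cfc_predicate Real.log Y : IsSelfAdjoint _)
  have hGVP := hlogY.neg.vonNeumannEntropy_sub_mul_le_log_partitionFn 1 hρpsd hρtr
  rw [partitionFn_one_eq hlogY.neg, neg_neg, cfc_exp_cfc_log hY, hYtr, Complex.ofReal_re, one_mul] at hGVP
  have hS := re_trace_mul_cfc_log hρpsd.1
  -- unfold `ρ = X / tX`
  have hlogρ : cfc Real.log ρ = (Real.log tX⁻¹ : ℂ) • (1 : Matrix d d ℂ) + cfc Real.log X :=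
    cfc_log_smul_of_posDef hX (inv_pos.mpr htXpos)
  have e1 : (ρ * cfc Real.log ρ).trace.re = Real.log tX⁻¹ + tX⁻¹ * (X * cfc Real.log X).trace.re := by
    rw [hlogρ, Matrix.mul_add, Matrix.trace_add, Complex.add_re, Matrix.mul_smul, Matrix.mul_one,
      Matrix.trace_smul, hρtr, smul_eq_mul, mul_one, Complex.ofReal_re, hρ, Matrix.smul_mul,
      Matrix.trace_smul, smul_eq_mul, Complex.re_ofReal_mul]
  have e2 : (ρ * -cfc Real.log Y).trace.re = -(tX⁻¹ * (X * cfc Real.log Y).trace.re) := by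
    rw [hρ, Matrix.smul_mul, Matrix.trace_smul, smul_eq_mul, Complex.re_ofReal_mul, Matrix.mul_neg,
      Matrix.trace_neg, Complex.neg_re, mul_neg]
  have hS' : vonNeumannEntropy ρ = -(ρ * cfc Real.log ρ).trace.re := by linarith
  rw [hS', e1, e2, Real.log_inv] at hGVP
  -- `hGVP : -(-log tX + tX⁻¹ Tr(X log X)) - -(tX⁻¹ Tr(X log Y)) ≤ log tY`
  have hD : quantumRelEntropy X Y = (X * cfc Real.log X).trace.re - (X * cfc Real.log Y).trace.re := by
    rw [quantumRelEntropy, Matrix.mul_sub, Matrix.trace_sub, Complex.sub_re]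
  rw [hD]
  have hlog : Real.log tX - Real.log tY ≤
      tX⁻¹ * (X * cfc Real.log X).trace.re - tX⁻¹ * (X * cfc Real.log Y).trace.re := by
    linarith
  have hmul : tX * (Real.log tX - Real.log tY) ≤
      (X * cfc Real.log X).trace.re - (X * cfc Real.log Y).trace.re := by
    have h := mul_le_mul_of_nonneg_left hlog htXpos.le
    have e : tX * (tX⁻¹ * (X * cfc Real.log X).trace.re - tX⁻¹ * (X * cfc Real.log Y).trace.re) =
        (X * cfc Real.log X).trace.re - (X * cfc Real.log Y).trace.re := by
      field_simp
    rw [e] at h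
    exact h
  -- `tX (log tX − log tY) ≥ tX − tY`
  have hsc : tX - tY ≤ tX * (Real.log tX - Real.log tY) := by
    have h := Real.log_le_sub_one_of_pos (div_pos htYpos htXpos)
    rw [Real.log_div htYpos.ne' htXpos.ne'] at h
    have h' : 1 - tY / tX ≤ Real.log tX - Real.log tY := by linarith
    have h2 := mul_le_mul_of_nonneg_left h' htXpos.le
    have e : tX * (1 - tY / tX) = tX - tY := by field_simp
    rw [e] at h2
    exact h2
  linarith

end Klein

/-! ### Lieb's Theorem 7 in supergradient form -/

section Lieb

variable {d : Type} [Fintype d] [DecidableEq d]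

/-- **The core of Lieb's theorem (abstract tangent datum).** Let `X₀, B₀, B` be positive definite and
`T` any matrix such that ALONG THE SEGMENT `B_t = (1−t)B₀ + tB` the first-order bound
`log B_t ≤ log B₀ + t T` holds (`0 < t < 1`). Then
`Re Tr exp(log X₀ − log B₀ + log B) ≤ Re Tr X₀ + Re Tr(X₀ T)`.
(Tropp's proof of Lieb's theorem, with the limit `t → 0⁺` of the affine upper bound replacing the
derivative: joint convexity of `D`, Klein, and the tangent bound.)
[cite: Tropp2012, §3 (proof of Theorem 1)] [cite: Lieb1973ConvexTrace, Lemma 5] -/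
theorem re_trace_exp_le_of_log_tangent {X₀ B₀ B T : Matrix d d ℂ} (hX₀ : X₀.PosDef) (hB₀ : B₀.PosDef)
    (hB : B.PosDef)
    (htan : ∀ t : ℝ, 0 < t → t < 1 →
      (cfc Real.log B₀ + ((t : ℝ) : ℂ) • T -
        cfc Real.log ((((1 - t : ℝ) : ℂ)) • B₀ + ((t : ℝ) : ℂ) • B)).PosSemidef) :
    (cfc Real.exp (cfc Real.log X₀ - cfc Real.log B₀ + cfc Real.log B)).trace.re ≤
      X₀.trace.re + (X₀ * T).trace.re := by
  -- `X = exp K`, `K = log X₀ − log B₀ + log B`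
  set K : Matrix d d ℂ := cfc Real.log X₀ - cfc Real.log B₀ + cfc Real.log B with hK
  have hlX₀ : (cfc Real.log X₀).IsHermitian := (cfc_predicate Real.log X₀ : IsSelfAdjoint _)
  have hlB₀ : (cfc Real.log B₀).IsHermitian := (cfc_predicate Real.log B₀ : IsSelfAdjoint _)
  have hlB : (cfc Real.log B).IsHermitian := (cfc_predicate Real.log B : IsSelfAdjoint _)
  have hKh : K.IsHermitian := (hlX₀.sub hlB₀).add hlB
  set X : Matrix d d ℂ := cfc Real.exp K with hX
  have hXpd : X.PosDef := posDef_cfc_exp hKh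
  have hlogX : cfc Real.log X = K := cfc_log_cfc_exp hKh
  -- the affine bound for every `t ∈ (0,1)`
  have hstep : ∀ t : ℝ, 0 < t → t < 1 →
      X.trace.re - X₀.trace.re ≤ (1 - t) * (X₀ * T).trace.re + t * (X * T).trace.re := by
    intro t ht0 ht1
    have h1t : 0 < 1 - t := by linarith
    set Xt : Matrix d d ℂ := (((1 - t : ℝ) : ℂ)) • X₀ + ((t : ℝ) : ℂ) • X with hXt
    set Bt : Matrix d d ℂ := (((1 - t : ℝ) : ℂ)) • B₀ + ((t : ℝ) : ℂ) • B with hBt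
    have hXtpd : Xt.PosDef := (hX₀.smul (by exact_mod_cast h1t)).add (hXpd.smul (by exact_mod_cast ht0))
    have hXtpsd : Xt.PosSemidef := hXtpd.posSemidef
    -- (1) joint convexity
    have hJC := quantumRelEntropy_convex_combination_le hX₀ hXpd hB₀ hB ht0 ht1
    -- (2) Klein at `(Xt, X₀)`
    have hKl := trace_sub_trace_le_quantumRelEntropy hXtpd hX₀
    -- (3) the tangent bound tested against `Xt ≥ 0`
    have hTan : (Xt * cfc Real.log Bt).trace.re ≤ (Xt * cfc Real.log B₀).trace.re + t * (Xt * T).trace.re := by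
      have h0 := re_trace_mul_nonneg_of_posSemidef hXtpsd (htan t ht0 ht1)
      rw [Matrix.mul_sub, Matrix.mul_add, Matrix.trace_sub, Matrix.trace_add, Complex.sub_re, Complex.add_re,
        Matrix.mul_smul, Matrix.trace_smul, smul_eq_mul, Complex.re_ofReal_mul] at h0
      linarith
    -- (4) the linear identity `Re Tr Xt (log X₀ − log B₀) = (1−t) D(X₀‖B₀) + t D(X‖B)`
    have hlin : (Xt * (cfc Real.log X₀ - cfc Real.log B₀)).trace.re =
        (1 - t) * quantumRelEntropy X₀ B₀ + t * quantumRelEntropy X B := by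
      have hKB : cfc Real.log X₀ - cfc Real.log B₀ = cfc Real.log X - cfc Real.log B := by
        rw [hlogX, hK]; abel
      unfold quantumRelEntropy
      rw [hXt, Matrix.add_mul, Matrix.trace_add, Complex.add_re, Matrix.smul_mul, Matrix.smul_mul,
        Matrix.trace_smul, Matrix.trace_smul, smul_eq_mul, smul_eq_mul, Complex.re_ofReal_mul,
        Complex.re_ofReal_mul, ← hKB]
    -- traces of `Xt`
    have htrXt : Xt.trace.re = (1 - t) * X₀.trace.re + t * X.trace.re := by
      rw [hXt, Matrix.trace_add, Matrix.trace_smul, Matrix.trace_smul, Complex.add_re, smul_eq_mul, smul_eq_mul,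
        Complex.re_ofReal_mul, Complex.re_ofReal_mul]
    have htrXtT : (Xt * T).trace.re = (1 - t) * (X₀ * T).trace.re + t * (X * T).trace.re := by
      rw [hXt, Matrix.add_mul, Matrix.trace_add, Matrix.smul_mul, Matrix.smul_mul, Matrix.trace_smul,
        Matrix.trace_smul, Complex.add_re, smul_eq_mul, smul_eq_mul, Complex.re_ofReal_mul, Complex.re_ofReal_mul]
    -- unfold the relative entropies in (1), (2)
    have eJ : quantumRelEntropy Xt Bt = (Xt * cfc Real.log Xt).trace.re - (Xt * cfc Real.log Bt).trace.re := by
      rw [quantumRelEntropy, Matrix.mul_sub, Matrix.trace_sub, Complex.sub_re]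
    have eK : quantumRelEntropy Xt X₀ = (Xt * cfc Real.log Xt).trace.re - (Xt * cfc Real.log X₀).trace.re := by
      rw [quantumRelEntropy, Matrix.mul_sub, Matrix.trace_sub, Complex.sub_re]
    have eL : (Xt * (cfc Real.log X₀ - cfc Real.log B₀)).trace.re =
        (Xt * cfc Real.log X₀).trace.re - (Xt * cfc Real.log B₀).trace.re := by
      rw [Matrix.mul_sub, Matrix.trace_sub, Complex.sub_re]
    rw [eJ] at hJC
    rw [eK, htrXt] at hKl
    rw [eL] at hlin
    rw [htrXtT] at hTan
    have hKl' : t * (X.trace.re - X₀.trace.re) ≤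
        (Xt * cfc Real.log Xt).trace.re - (Xt * cfc Real.log X₀).trace.re := by
      have e : t * (X.trace.re - X₀.trace.re) = (1 - t) * X₀.trace.re + t * X.trace.re - X₀.trace.re := by ring
      rw [e]; exact hKl
    -- combine: `t (Tr X − Tr X₀) ≤ t · [(1−t) Re Tr(X₀T) + t Re Tr(XT)]`
    have hmain : t * (X.trace.re - X₀.trace.re) ≤ t * ((1 - t) * (X₀ * T).trace.re + t * (X * T).trace.re) := by
      linarith
    exact le_of_mul_le_mul_left hmain ht0
  -- let `t → 0⁺`
  have hlim : Tendsto (fun t : ℝ => (1 - t) * (X₀ * T).trace.re + t * (X * T).trace.re) (𝓝[>] 0)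
      (𝓝 ((1 - 0) * (X₀ * T).trace.re + 0 * (X * T).trace.re)) := by
    refine (Continuous.tendsto ?_ 0).mono_left nhdsWithin_le_nhds
    fun_prop
  rw [sub_zero, one_mul, zero_mul, add_zero] at hlim
  have hev : ∀ᶠ t in 𝓝[>] (0 : ℝ), X.trace.re - X₀.trace.re ≤ (1 - t) * (X₀ * T).trace.re + t * (X * T).trace.re := by
    filter_upwards [Ioo_mem_nhdsGT (zero_lt_one' ℝ)] with t ht
    exact hstep t ht.1 ht.2
  have := ge_of_tendsto hlim hev
  rw [hX, hK] at this
  linarith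

variable {V : Matrix d d ℂ} {μ : d → ℝ}

/-- `V diag(μ) V⋆` is positive definite for unitary `V` and `μ > 0`. [folklore] -/
private theorem posDef_conj_diagonal (hV : V ∈ Matrix.unitaryGroup d ℂ) (hμ : ∀ k, 0 < μ k) :
    (V * diagonal (fun k => ((μ k : ℝ) : ℂ)) * star V).PosDef :=
  (Matrix.IsUnit.posDef_star_right_conjugate_iff
      (⟨⟨V, star V, Unitary.mul_star_self_of_mem hV, Unitary.star_mul_self_of_mem hV⟩, rfl⟩ : IsUnit V)).mpr
    (Matrix.PosDef.diagonal fun k => by exact_mod_cast hμ k)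

/-- **Lieb's triple-matrix inequality, supergradient form** (Lieb 1973, Theorem 7, via Lemma 5 and
Theorem 6): for positive definite `X₀`, `B` and `B₀ = V diag(μ) V⋆` (`V` unitary, `μ > 0`),
`Re Tr exp(log X₀ − log B₀ + log B) ≤ Re Tr(X₀ · dlog_{B₀}[B])`, where `dlog_{B₀} = logFrechet V μ` is
the Fréchet derivative of `log` at `B₀` (Lieb's `T_{B₀}`; equality at `B = B₀`). This is the
first-order bound `F(B) ≤ dF(B₀)[B]` of the concave, 1-homogeneous `F = Tr exp(L + log ·)`,
`L = log X₀ − log B₀`. [cite: Lieb1973ConvexTrace, Theorem 7] [cite: Petz2008, Theorem 11.29] -/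
theorem lieb_triple_matrix_inequality' {X₀ B₀ B : Matrix d d ℂ} (hX₀ : X₀.PosDef)
    (hV : V ∈ Matrix.unitaryGroup d ℂ) (hBV : B₀ = V * diagonal (fun k => ((μ k : ℝ) : ℂ)) * star V)
    (hμ : ∀ k, 0 < μ k) (hB : B.PosDef) :
    (cfc Real.exp (cfc Real.log X₀ - cfc Real.log B₀ + cfc Real.log B)).trace.re ≤
      (X₀ * logFrechet V μ B).trace.re := by
  have hB₀ : B₀.PosDef := hBV ▸ posDef_conj_diagonal hV hμ
  have htan : ∀ t : ℝ, 0 < t → t < 1 →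
      (cfc Real.log B₀ + ((t : ℝ) : ℂ) • logFrechet V μ (B - B₀) -
        cfc Real.log ((((1 - t : ℝ) : ℂ)) • B₀ + ((t : ℝ) : ℂ) • B)).PosSemidef := by
    intro t ht0 ht1
    have h1t : 0 < 1 - t := by linarith
    have hBt : ((((1 - t : ℝ) : ℂ)) • B₀ + ((t : ℝ) : ℂ) • B).PosDef :=
      (hB₀.smul (by exact_mod_cast h1t)).add (hB.smul (by exact_mod_cast ht0))
    have h := posSemidef_log_add_logFrechet_sub_log hV hBV hμ hBt
    have e : (((1 - t : ℝ) : ℂ)) • B₀ + ((t : ℝ) : ℂ) • B - B₀ = ((t : ℝ) : ℂ) • (B - B₀) := by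
      rw [smul_sub, Complex.ofReal_sub, Complex.ofReal_one, sub_smul, one_smul]; abel
    rwa [e, logFrechet_smul] at h
  have hcore := re_trace_exp_le_of_log_tangent hX₀ hB₀ hB htan
  have hself : logFrechet V μ B₀ = 1 := by
    have h := logFrechet_self hV (μ := μ) (fun k => (hμ k).ne')
    rwa [← hBV] at h
  rw [logFrechet_sub, hself, Matrix.mul_sub, Matrix.mul_one, Matrix.trace_sub, Complex.sub_re] at hcore
  linarith

/-- **Lieb's triple-matrix inequality** (Lieb 1973, Theorem 7: "`Tr e^C T_{exp(−A)}(e^B) ≥ Tr e^{A+B+C}`";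
Petz 2008, Theorem 11.29: `Tr e^{A+B+C} ≤ ∫₀^∞ Tr (t + e^{−A})⁻¹ e^B (t + e^{−A})⁻¹ e^C dt`), for
Hermitian `A, B, C`, with Lieb's map `T_{e^{−A}}` written as `logFrechet` at the diagonalisation
`e^{−A} = W diag(e^{−λ}) W⋆` by Mathlib's eigendata `(W, λ)` of `A`.
[cite: Lieb1973ConvexTrace, Theorem 7] [cite: Petz2008, Theorem 11.29] -/
theorem lieb_triple_matrix_inequality {A B C : Matrix d d ℂ} (hA : A.IsHermitian) (hB : B.IsHermitian)
    (hC : C.IsHermitian) :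
    (cfc Real.exp (A + B + C)).trace.re ≤
      (cfc Real.exp C * logFrechet (hA.eigenvectorUnitary : Matrix d d ℂ)
        (fun k => Real.exp (-hA.eigenvalues k)) (cfc Real.exp B)).trace.re := by
  set W : Matrix d d ℂ := (hA.eigenvectorUnitary : Matrix d d ℂ) with hW
  have hWu : W ∈ Matrix.unitaryGroup d ℂ := hA.eigenvectorUnitary.2
  have hAW : A = W * diagonal (fun k => ((hA.eigenvalues k : ℝ) : ℂ)) * star W := hA.spectral_theorem
  -- `e^{−A} = W diag(e^{−λ}) W⋆`
  have hnegA : -A = W * diagonal (fun k => ((-hA.eigenvalues k : ℝ) : ℂ)) * star W := by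
    have e : W * diagonal (fun k => ((-hA.eigenvalues k : ℝ) : ℂ)) * star W =
        -(W * diagonal (fun k => ((hA.eigenvalues k : ℝ) : ℂ)) * star W) := by
      rw [← neg_mul, ← mul_neg, diagonal_neg]
      congr 2
      funext k
      push_cast
      ring
    rw [e, ← hAW]
  have hEA : cfc Real.exp (-A) = W * diagonal (fun k => ((Real.exp (-hA.eigenvalues k) : ℝ) : ℂ)) * star W :=
    cfc_eq_conj_diagonal hWu hnegA Real.exp
  have h := lieb_triple_matrix_inequality' (posDef_cfc_exp hC) hWu hEA (fun k => Real.exp_pos _)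
    (posDef_cfc_exp hB)
  rw [cfc_log_cfc_exp hC, cfc_log_cfc_exp hA.neg, cfc_log_cfc_exp hB] at h
  have e : C - -A + B = A + B + C := by abel
  rwa [e] at h

/-- **Lieb's concavity theorem** (Lieb 1973, Theorem 6; Tropp 2012, Theorem 1): for Hermitian `K`
the map `A ↦ Tr exp(K + log A)` is concave on positive definite matrices:
`(1−t) F(A₀) + t F(A₁) ≤ F((1−t)A₀ + tA₁)` for `0 ≤ t ≤ 1`. Proof: the supergradient inequality at
`A_t` (`F(Aᵢ) ≤ Re Tr(e^{K + log A_t} dlog_{A_t}[Aᵢ])`), linearity of `dlog_{A_t}` and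
`dlog_{A_t}[A_t] = 1` (Lieb 1973, §5 (b): "Theorem 7 ⇒ Theorem 6 by the second part of Lemma 5").
[cite: Lieb1973ConvexTrace, Theorem 6] [cite: Tropp2012, Theorem 1] -/
theorem lieb_concavity {K A₀ A₁ : Matrix d d ℂ} (hK : K.IsHermitian) (hA₀ : A₀.PosDef) (hA₁ : A₁.PosDef)
    {t : ℝ} (ht0 : 0 ≤ t) (ht1 : t ≤ 1) :
    (1 - t) * (cfc Real.exp (K + cfc Real.log A₀)).trace.re + t * (cfc Real.exp (K + cfc Real.log A₁)).trace.re ≤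
      (cfc Real.exp (K + cfc Real.log ((((1 - t : ℝ) : ℂ)) • A₀ + ((t : ℝ) : ℂ) • A₁))).trace.re := by
  set At : Matrix d d ℂ := (((1 - t : ℝ) : ℂ)) • A₀ + ((t : ℝ) : ℂ) • A₁ with hAt
  -- `A_t` is positive definite
  have hAtpd : At.PosDef := by
    rcases eq_or_lt_of_le ht1 with h1 | h1
    · have : At = A₁ := by rw [hAt, h1]; simp
      rw [this]; exact hA₁
    · exact (hA₀.smul (by exact_mod_cast (by linarith : (0:ℝ) < 1 - t))).add_posSemidef
        (hA₁.posSemidef.smul (by exact_mod_cast ht0))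
  -- eigendata of `A_t`
  set W : Matrix d d ℂ := (hAtpd.1.eigenvectorUnitary : Matrix d d ℂ) with hW
  have hWu : W ∈ Matrix.unitaryGroup d ℂ := hAtpd.1.eigenvectorUnitary.2
  have hAW : At = W * diagonal (fun k => ((hAtpd.1.eigenvalues k : ℝ) : ℂ)) * star W := hAtpd.1.spectral_theorem
  have hν : ∀ k, 0 < hAtpd.1.eigenvalues k := fun k => hAtpd.eigenvalues_pos k
  -- `X₀ = exp(K + log A_t)`
  have hlAt : (cfc Real.log At).IsHermitian := (cfc_predicate Real.log At : IsSelfAdjoint _)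
  set X₀ : Matrix d d ℂ := cfc Real.exp (K + cfc Real.log At) with hX₀
  have hX₀pd : X₀.PosDef := posDef_cfc_exp (hK.add hlAt)
  have hlogX₀ : cfc Real.log X₀ = K + cfc Real.log At := cfc_log_cfc_exp (hK.add hlAt)
  -- the two supergradient inequalities
  have key : ∀ {A : Matrix d d ℂ}, A.PosDef →
      (cfc Real.exp (K + cfc Real.log A)).trace.re ≤ (X₀ * logFrechet W (hAtpd.1.eigenvalues) A).trace.re := by
    intro A hA
    have h := lieb_triple_matrix_inequality' hX₀pd hWu hAW hν hA
    have e : cfc Real.log X₀ - cfc Real.log At + cfc Real.log A = K + cfc Real.log A := by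
      rw [hlogX₀]; abel
    rwa [e] at h
  have h0 := key hA₀
  have h1 := key hA₁
  -- `(1−t) dlog[A₀] + t dlog[A₁] = dlog[A_t] = 1`
  have hsum : (((1 - t : ℝ) : ℂ)) • logFrechet W (hAtpd.1.eigenvalues) A₀ +
      ((t : ℝ) : ℂ) • logFrechet W (hAtpd.1.eigenvalues) A₁ = 1 := by
    rw [← logFrechet_smul, ← logFrechet_smul, ← logFrechet_add, ← hAt]
    have h := logFrechet_self hWu (μ := hAtpd.1.eigenvalues) (fun k => (hν k).ne')
    rwa [← hAW] at h
  have htr : (1 - t) * (X₀ * logFrechet W (hAtpd.1.eigenvalues) A₀).trace.re +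
      t * (X₀ * logFrechet W (hAtpd.1.eigenvalues) A₁).trace.re = X₀.trace.re := by
    have := congrArg (fun M => (X₀ * M).trace.re) hsum
    simp only [Matrix.mul_add, Matrix.mul_smul, Matrix.trace_add, Matrix.trace_smul, smul_eq_mul,
      Complex.add_re, Complex.re_ofReal_mul, Matrix.mul_one] at this
    exact this
  have h1t : 0 ≤ 1 - t := by linarith
  calc (1 - t) * (cfc Real.exp (K + cfc Real.log A₀)).trace.re + t * (cfc Real.exp (K + cfc Real.log A₁)).trace.re
      ≤ (1 - t) * (X₀ * logFrechet W (hAtpd.1.eigenvalues) A₀).trace.re +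
          t * (X₀ * logFrechet W (hAtpd.1.eigenvalues) A₁).trace.re :=
        add_le_add (mul_le_mul_of_nonneg_left h0 h1t) (mul_le_mul_of_nonneg_left h1 ht0)
    _ = X₀.trace.re := htr

end Lieb

/-! ### The Lieb-constant certificate for the conditional free energy -/

section Certificate

variable {m n : Type} [Fintype m] [Fintype n] [DecidableEq m] [DecidableEq n]

omit [Fintype m] [Fintype n] [DecidableEq m] [DecidableEq n] in
/-- `A ⊗ (B − C) = A ⊗ B − A ⊗ C`. [folklore] -/
private theorem kronecker_sub_right (A : Matrix m m ℂ) (B C : Matrix n n ℂ) :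
    A ⊗ₖ (B - C) = A ⊗ₖ B - A ⊗ₖ C := by
  ext ⟨i, k⟩ ⟨j, l⟩; simp [Matrix.kroneckerMap_apply, mul_sub]

omit [Fintype m] [Fintype n] [DecidableEq m] [DecidableEq n] in
/-- `A ⊗ (−B) = −(A ⊗ B)`. [folklore] -/
private theorem kronecker_neg_right (A : Matrix m m ℂ) (B : Matrix n n ℂ) : A ⊗ₖ (-B) = -(A ⊗ₖ B) := by
  ext ⟨i, k⟩ ⟨j, l⟩; simp [Matrix.kroneckerMap_apply]

omit [Fintype m] [Fintype n] [DecidableEq m] [DecidableEq n] in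
/-- The Kronecker product of Hermitian matrices is Hermitian. [folklore] -/
private theorem isHermitian_kronecker' {A : Matrix m m ℂ} {B : Matrix n n ℂ} (hA : A.IsHermitian)
    (hB : B.IsHermitian) : (A ⊗ₖ B).IsHermitian := by
  rw [Matrix.IsHermitian, Matrix.conjTranspose_kronecker, hA.eq, hB.eq]

/-- `f(𝟙 ⊗ N) = 𝟙 ⊗ f(N)` for Hermitian `N` (the tree's `cfc_diagonal_kronecker` at `c = 1`).
[cite: HornJohnson2013, §4.1 Theorem 4.1.5] -/
theorem cfc_one_kronecker {N : Matrix n n ℂ} (hN : N.IsHermitian) (f : ℝ → ℝ) :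
    cfc f ((1 : Matrix m m ℂ) ⊗ₖ N) = (1 : Matrix m m ℂ) ⊗ₖ cfc f N := by
  have h := cfc_diagonal_kronecker (A := m) hN 1 f
  simp only [Complex.ofReal_one, diagonal_one, one_mul] at h
  exact h

/-- `Tr ρ_B log ρ_B ≤ Tr ρ_B log(ρ_B + ε)` for `ρ_B ≥ 0`, `ε > 0` (eigenvalue-wise `p log p ≤ p log(p+ε)`).
[cite: Petz2008, proof of Theorem 3.10 (approximation argument)] -/
theorem re_trace_mul_log_le_re_trace_mul_log_add_smul {P : Matrix n n ℂ} (hP : P.PosSemidef) {ε : ℝ}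
    (hε : 0 < ε) :
    (P * cfc Real.log P).trace.re ≤ (P * cfc Real.log (P + ((ε : ℝ) : ℂ) • (1 : Matrix n n ℂ))).trace.re := by
  set W : Matrix n n ℂ := (hP.1.eigenvectorUnitary : Matrix n n ℂ) with hW
  have hWu : W ∈ Matrix.unitaryGroup n ℂ := hP.1.eigenvectorUnitary.2
  have hPW : P = W * diagonal (fun k => ((hP.1.eigenvalues k : ℝ) : ℂ)) * star W := hP.1.spectral_theorem
  have hW2 : W * star W = 1 := Unitary.mul_star_self_of_mem hWu
  have hPεW : P + ((ε : ℝ) : ℂ) • (1 : Matrix n n ℂ) =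
      W * diagonal (fun k => ((hP.1.eigenvalues k + ε : ℝ) : ℂ)) * star W := by
    have e : W * diagonal (fun k => ((hP.1.eigenvalues k : ℝ) : ℂ)) * star W + ((ε : ℝ) : ℂ) • (1 : Matrix n n ℂ) =
        W * diagonal (fun k => ((hP.1.eigenvalues k + ε : ℝ) : ℂ)) * star W := by
      calc W * diagonal (fun k => ((hP.1.eigenvalues k : ℝ) : ℂ)) * star W + ((ε : ℝ) : ℂ) • (1 : Matrix n n ℂ)
          = W * diagonal (fun k => ((hP.1.eigenvalues k : ℝ) : ℂ)) * star W + W * (((ε : ℝ) : ℂ) • 1) * star W := by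
            rw [Matrix.mul_smul, Matrix.mul_one, Matrix.smul_mul, hW2]
        _ = W * (diagonal (fun k => ((hP.1.eigenvalues k : ℝ) : ℂ)) + ((ε : ℝ) : ℂ) • 1) * star W := by
            rw [Matrix.mul_add, Matrix.add_mul]
        _ = _ := by
            rw [smul_one_eq_diagonal, diagonal_add]
            congr 2; funext k; push_cast; rfl
    rwa [← hPW] at e
  -- both traces in the eigenbasis
  have htr : ∀ (g : n → ℝ), (P * (W * diagonal (fun k => ((g k : ℝ) : ℂ)) * star W)).trace.re =
      ∑ k, hP.1.eigenvalues k * g k := by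
    intro g
    conv_lhs => rw [hPW]
    have hmul : W * diagonal (fun k => ((hP.1.eigenvalues k : ℝ) : ℂ)) * star W *
        (W * diagonal (fun k => ((g k : ℝ) : ℂ)) * star W) =
        W * diagonal (fun k => ((hP.1.eigenvalues k * g k : ℝ) : ℂ)) * star W := by
      have h1 : star W * W = 1 := Unitary.star_mul_self_of_mem hWu
      calc _ = W * diagonal (fun k => ((hP.1.eigenvalues k : ℝ) : ℂ)) * (star W * W) *
            diagonal (fun k => ((g k : ℝ) : ℂ)) * star W := by simp only [Matrix.mul_assoc]
        _ = _ := by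
            rw [h1, Matrix.mul_one, Matrix.mul_assoc W, diagonal_mul_diagonal]
            congr 2; funext k; push_cast; rfl
    rw [hmul, trace_unitary_conj hWu, trace_diagonal, Complex.re_sum]
    simp only [Complex.ofReal_re]
  have hl1 : cfc Real.log P = W * diagonal (fun k => ((Real.log (hP.1.eigenvalues k) : ℝ) : ℂ)) * star W :=
    cfc_eq_conj_diagonal hWu hPW Real.log
  have hl2 : cfc Real.log (P + ((ε : ℝ) : ℂ) • (1 : Matrix n n ℂ)) =
      W * diagonal (fun k => ((Real.log (hP.1.eigenvalues k + ε) : ℝ) : ℂ)) * star W :=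
    cfc_eq_conj_diagonal hWu hPεW Real.log
  rw [hl1, hl2, htr, htr]
  refine Finset.sum_le_sum fun k _ => ?_
  rcases (hP.eigenvalues_nonneg k).eq_or_lt with h0 | hpos
  · rw [← h0]; simp
  · exact mul_le_mul_of_nonneg_left (Real.log_le_log hpos (by linarith)) hpos.le

/-- **Lieb-constant certificate for the conditional free energy.** Let `ρ` be a density matrix on
`ℋ_A ⊗ ℋ_B` (index `m × n`, `Tr_A = traceLeft`), `H` Hermitian, `σ₀ = V diag(μ) V⋆` positive definite
(`V` unitary, `μ > 0`) with derivative map `dlog_{σ₀} = logFrechet V μ`, `Z⁺ ≥ Tr_A exp(−H + 𝟙 ⊗ log σ₀)`,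
and `c` real with the CERTIFICATE `e^c · 1 − dlog_{σ₀}[Z⁺] ≥ 0`. Then
`S(ρ) − S(Tr_A ρ) − Re tr(ρ H) ≤ c`. (The optimal constant `c⋆ = sup_σ log(Φ(σ)/Tr σ)`,
`Φ(σ) = Tr exp(−H + 𝟙 ⊗ log σ)`, is bounded by `log λ_max(dΦ(σ₀))` by LIEB CONCAVITY and
1-homogeneity of `Φ`; here via Lieb's supergradient inequality on `ℋ_A ⊗ ℋ_B` with tangent
`𝟙 ⊗ dlog_{σ₀}`.) [cite: Lieb1973ConvexTrace, Theorems 6–7] [cite: PoulinHastings2011, eqs. (4)–(8)] -/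
theorem vonNeumannEntropy_sub_traceLeft_sub_le_of_liebCertificate [Nonempty m] [Nonempty n]
    {ρ H : Matrix (m × n) (m × n) ℂ} {σ₀ Zp V : Matrix n n ℂ} {μ : n → ℝ} {c : ℝ}
    (hρ : ρ.PosSemidef) (htr : ρ.trace = 1) (hH : H.IsHermitian)
    (hV : V ∈ Matrix.unitaryGroup n ℂ) (hμ : ∀ k, 0 < μ k)
    (hσV : σ₀ = V * diagonal (fun k => ((μ k : ℝ) : ℂ)) * star V)
    (hZ : (Zp - traceLeft (cfc Real.exp (-H + (1 : Matrix m m ℂ) ⊗ₖ cfc Real.log σ₀))).PosSemidef)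
    (hcert : (((Real.exp c : ℝ) : ℂ) • (1 : Matrix n n ℂ) - logFrechet V μ Zp).PosSemidef) :
    vonNeumannEntropy ρ - vonNeumannEntropy (traceLeft ρ) - (ρ * H).trace.re ≤ c := by
  -- notation and basic facts
  have hσ₀h : σ₀.IsHermitian := hσV ▸ isHermitian_conj_diagonal V μ
  have hσ₀pd : σ₀.PosDef := hσV ▸ posDef_conj_diagonal hV hμ
  have hselfσ : logFrechet V μ σ₀ = 1 := by
    have h := logFrechet_self hV (μ := μ) (fun k => (hμ k).ne')
    rwa [← hσV] at h
  set ρB : Matrix n n ℂ := traceLeft ρ with hρB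
  have hρBpsd : ρB.PosSemidef := posSemidef_traceLeft hρ
  have hρBtr : ρB.trace = 1 := by rw [hρB, trace_traceLeft, htr]
  have hlσ₀ : (cfc Real.log σ₀).IsHermitian := (cfc_predicate Real.log σ₀ : IsSelfAdjoint _)
  -- the reference Gibbs operator `X₀ = exp(−H + 𝟙 ⊗ log σ₀)` and `Z = Tr_A X₀ ≤ Z⁺`
  set L : Matrix (m × n) (m × n) ℂ := -H + (1 : Matrix m m ℂ) ⊗ₖ cfc Real.log σ₀ with hL
  have hLh : L.IsHermitian := hH.neg.add (isHermitian_kronecker' Matrix.isHermitian_one hlσ₀)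
  set X₀ : Matrix (m × n) (m × n) ℂ := cfc Real.exp L with hX₀
  have hX₀pd : X₀.PosDef := posDef_cfc_exp hLh
  have hlogX₀ : cfc Real.log X₀ = L := cfc_log_cfc_exp hLh
  -- it suffices to prove the bound up to `ε |n|` for every `ε > 0`
  refine le_of_forall_pos_le_add fun δ hδ => ?_
  -- choose `ε` with `ε · |n| ≤ δ`
  set N : ℝ := (Fintype.card n : ℝ) with hN
  have hNpos : 0 < N := by rw [hN]; exact_mod_cast Fintype.card_pos
  set ε : ℝ := δ / N with hεdef
  have hε : 0 < ε := div_pos hδ hNpos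
  -- the perturbed marginal `A = ρ_B + ε`
  set A : Matrix n n ℂ := ρB + ((ε : ℝ) : ℂ) • (1 : Matrix n n ℂ) with hA
  have hApd' : A.PosDef := by
    rw [hA]; exact Matrix.PosDef.posSemidef_add hρBpsd (Matrix.PosDef.one.smul (by exact_mod_cast hε))
  clear_value A
  have hAh : A.IsHermitian := hApd'.1
  have hlA : (cfc Real.log A).IsHermitian := (cfc_predicate Real.log A : IsSelfAdjoint _)
  have htrA : A.trace.re = 1 + ε * N := by
    rw [hA, Matrix.trace_add, Matrix.trace_smul, hρBtr, Matrix.trace_one, Complex.add_re, Complex.one_re,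
      smul_eq_mul, Complex.re_ofReal_mul, hN]
    simp
  -- (a) Gibbs variational principle with `H' = H − 𝟙 ⊗ log A`
  set H' : Matrix (m × n) (m × n) ℂ := H - (1 : Matrix m m ℂ) ⊗ₖ cfc Real.log A with hH'
  have hH'h : H'.IsHermitian := hH.sub (isHermitian_kronecker' Matrix.isHermitian_one hlA)
  have hGVP := hH'h.vonNeumannEntropy_sub_mul_le_log_partitionFn 1 hρ htr
  rw [one_mul, partitionFn_one_eq hH'h] at hGVP
  have hnegH' : -H' = -H + (1 : Matrix m m ℂ) ⊗ₖ cfc Real.log A := by rw [hH']; abel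
  rw [hnegH'] at hGVP
  set F : ℝ := (cfc Real.exp (-H + (1 : Matrix m m ℂ) ⊗ₖ cfc Real.log A)).trace.re with hF
  have hFtr : (cfc Real.exp (-H + (1 : Matrix m m ℂ) ⊗ₖ cfc Real.log A)).trace = (F : ℂ) := by
    apply Complex.ext
    · simp [hF]
    · rw [Complex.ofReal_im]
      exact Literature.LinearAlgebra.Matrix.trace_im_of_posSemidef
        (posDef_cfc_exp (hH.neg.add (isHermitian_kronecker' Matrix.isHermitian_one hlA))).posSemidef
  have hFpos : 0 < F := by
    have h := (posDef_cfc_exp (hH.neg.add (isHermitian_kronecker' Matrix.isHermitian_one hlA))).trace_pos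
    rw [hFtr] at h; exact_mod_cast h
  -- `Re tr(ρ H') = Re tr(ρ H) − Re tr(ρ_B log A)`
  have hρH' : (ρ * H').trace.re = (ρ * H).trace.re - (ρB * cfc Real.log A).trace.re := by
    rw [hH', Matrix.mul_sub, Matrix.trace_sub, Complex.sub_re, trace_mul_one_kronecker]
  rw [hρH'] at hGVP
  -- (b) `−S(ρ_B) ≤ Re tr(ρ_B log A)`
  have hSB : -vonNeumannEntropy ρB ≤ (ρB * cfc Real.log A).trace.re := by
    rw [← re_trace_mul_cfc_log hρBpsd.1, hA]
    exact re_trace_mul_log_le_re_trace_mul_log_add_smul hρBpsd hε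
  -- (c) Lieb's supergradient inequality on `ℋ_A ⊗ ℋ_B` with tangent `𝟙 ⊗ dlog_{σ₀}`
  set T : Matrix (m × n) (m × n) ℂ := (1 : Matrix m m ℂ) ⊗ₖ logFrechet V μ (A - σ₀) with hT
  have hB₀pd : ((1 : Matrix m m ℂ) ⊗ₖ σ₀).PosDef := Matrix.PosDef.one.kronecker hσ₀pd
  have hBpd : ((1 : Matrix m m ℂ) ⊗ₖ A).PosDef := Matrix.PosDef.one.kronecker hApd'
  have htan : ∀ t : ℝ, 0 < t → t < 1 →
      (cfc Real.log ((1 : Matrix m m ℂ) ⊗ₖ σ₀) + ((t : ℝ) : ℂ) • T -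
        cfc Real.log ((((1 - t : ℝ) : ℂ)) • ((1 : Matrix m m ℂ) ⊗ₖ σ₀) +
          ((t : ℝ) : ℂ) • ((1 : Matrix m m ℂ) ⊗ₖ A))).PosSemidef := by
    intro t ht0 ht1
    have h1t : 0 < 1 - t := by linarith
    set At : Matrix n n ℂ := (((1 - t : ℝ) : ℂ)) • σ₀ + ((t : ℝ) : ℂ) • A with hAt
    have hAtpd : At.PosDef := (hσ₀pd.smul (by exact_mod_cast h1t)).add (hApd'.smul (by exact_mod_cast ht0))
    have hsmall := posSemidef_log_add_logFrechet_sub_log hV hσV hμ hAtpd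
    have e1 : At - σ₀ = ((t : ℝ) : ℂ) • (A - σ₀) := by
      rw [hAt, smul_sub, Complex.ofReal_sub, Complex.ofReal_one, sub_smul, one_smul]; abel
    rw [e1, logFrechet_smul] at hsmall
    have hkron : (((1 - t : ℝ) : ℂ)) • ((1 : Matrix m m ℂ) ⊗ₖ σ₀) + ((t : ℝ) : ℂ) • ((1 : Matrix m m ℂ) ⊗ₖ A) =
        (1 : Matrix m m ℂ) ⊗ₖ At := by
      rw [hAt, Matrix.kronecker_add, ← Matrix.kronecker_smul, ← Matrix.kronecker_smul]
    rw [hkron, cfc_one_kronecker hσ₀h, cfc_one_kronecker hAtpd.1, hT, ← Matrix.kronecker_smul,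
      ← Matrix.kronecker_add, ← kronecker_sub_right]
    exact Matrix.PosSemidef.one.kronecker hsmall
  have hLieb := re_trace_exp_le_of_log_tangent hX₀pd hB₀pd hBpd htan
  rw [hlogX₀, cfc_one_kronecker hσ₀h, cfc_one_kronecker hAh, hL, add_sub_cancel_right] at hLieb
  have hLieb' : F ≤ X₀.trace.re + (X₀ * T).trace.re := by rw [hF]; exact hLieb
  -- rewrite the right side on `ℋ_B`
  have hXT : (X₀ * T).trace.re = (traceLeft X₀ * logFrechet V μ A).trace.re - X₀.trace.re := by
    rw [hT, trace_mul_one_kronecker, logFrechet_sub, hselfσ, Matrix.mul_sub, Matrix.mul_one, Matrix.trace_sub,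
      Complex.sub_re, trace_traceLeft]
  rw [hXT] at hLieb'
  -- (d) `Re Tr(Z dlog A) = Re Tr(dlog Z · A) ≤ Re Tr(dlog Z⁺ · A) ≤ e^c Tr A`, `Z = Tr_A X₀`
  have hstep1 : (traceLeft X₀ * logFrechet V μ A).trace.re = (A * logFrechet V μ (traceLeft X₀)).trace.re := by
    rw [trace_mul_logFrechet_comm, Matrix.trace_mul_comm]
  have hstep2 : (A * logFrechet V μ (traceLeft X₀)).trace.re ≤ (A * logFrechet V μ Zp).trace.re := by
    have h := re_trace_mul_nonneg_of_posSemidef hApd'.posSemidef (logFrechet_mono hV hμ hZ)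
    rw [Matrix.mul_sub, Matrix.trace_sub, Complex.sub_re] at h
    linarith
  have hstep3 : (A * logFrechet V μ Zp).trace.re ≤ Real.exp c * (1 + ε * N) := by
    have h := re_trace_mul_nonneg_of_posSemidef hApd'.posSemidef hcert
    rw [Matrix.mul_sub, Matrix.trace_sub, Complex.sub_re, Matrix.mul_smul, Matrix.mul_one, Matrix.trace_smul,
      smul_eq_mul, Complex.re_ofReal_mul, htrA] at h
    linarith
  -- (e) assemble: `Φ ≤ log F ≤ c + log(1 + εN) ≤ c + εN = c + δ`
  have hF_le : F ≤ Real.exp c * (1 + ε * N) := by linarith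
  have hεN : ε * N = δ := by rw [hεdef, div_mul_cancel₀ _ hNpos.ne']
  have hlogF : Real.log F ≤ c + δ := by
    have h1 : Real.log F ≤ Real.log (Real.exp c * (1 + ε * N)) := Real.log_le_log hFpos hF_le
    have h2 : Real.log (Real.exp c * (1 + ε * N)) = c + Real.log (1 + ε * N) := by
      rw [Real.log_mul (Real.exp_pos c).ne' (by positivity), Real.log_exp]
    have h3 : Real.log (1 + ε * N) ≤ ε * N := by
      have := Real.log_le_sub_one_of_pos (by positivity : 0 < 1 + ε * N); linarith
    linarith
  linarith

/-- **The conditional-entropy row with the Lieb constant** (the form used by entropy-constrained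
thermal relaxations): for every density matrix `ρ` on `ℋ_A ⊗ ℋ_B`, Hermitian `G` on `ℋ_A ⊗ ℋ_B` and
`G_W = V diag(u) V⋆` on `ℋ_B` (`V` unitary, `u` real), every `Z⁺ ≥ Tr_A e^{−G}` and every real `c` with
`e^c · 1 ≥ dlog_{σ₀}[Z⁺]`, `σ₀ = e^{−G_W} = V diag(e^{−u}) V⋆` (Loewner matrix
`L_ij = (u_j − u_i)/(e^{−u_i} − e^{−u_j})`, `L_ii = e^{u_i}`):
`S(ρ) − S(Tr_A ρ) ≤ Re tr(ρ G) − Re tr(Tr_A ρ · G_W) + c`.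
[cite: Lieb1973ConvexTrace, Theorems 6–7] [cite: PoulinHastings2011, eqs. (4)–(8)] -/
theorem condEntropy_le_of_liebCertificate [Nonempty m] [Nonempty n]
    {ρ G : Matrix (m × n) (m × n) ℂ} {GW Zp V : Matrix n n ℂ} {u : n → ℝ} {c : ℝ}
    (hρ : ρ.PosSemidef) (htr : ρ.trace = 1) (hG : G.IsHermitian)
    (hV : V ∈ Matrix.unitaryGroup n ℂ) (hGW : GW = V * diagonal (fun k => ((u k : ℝ) : ℂ)) * star V)
    (hZ : (Zp - traceLeft (cfc Real.exp (-G))).PosSemidef)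
    (hcert : (((Real.exp c : ℝ) : ℂ) • (1 : Matrix n n ℂ) - logFrechet V (fun k => Real.exp (-u k)) Zp).PosSemidef) :
    vonNeumannEntropy ρ - vonNeumannEntropy (traceLeft ρ) ≤
      (ρ * G).trace.re - (traceLeft ρ * GW).trace.re + c := by
  have hGWh : GW.IsHermitian := hGW ▸ isHermitian_conj_diagonal V u
  -- `σ₀ = e^{−G_W} = V diag(e^{−u}) V⋆`, `log σ₀ = −G_W`
  have hnegGW : -GW = V * diagonal (fun k => ((-u k : ℝ) : ℂ)) * star V := by
    have e : V * diagonal (fun k => ((-u k : ℝ) : ℂ)) * star V = -(V * diagonal (fun k => ((u k : ℝ) : ℂ)) * star V) := by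
      rw [← neg_mul, ← mul_neg, diagonal_neg]
      congr 2; funext k; push_cast; ring
    rw [e, ← hGW]
  have hσV : cfc Real.exp (-GW) = V * diagonal (fun k => ((Real.exp (-u k) : ℝ) : ℂ)) * star V :=
    cfc_eq_conj_diagonal hV hnegGW Real.exp
  have hlogσ : cfc Real.log (cfc Real.exp (-GW)) = -GW := cfc_log_cfc_exp hGWh.neg
  set H : Matrix (m × n) (m × n) ℂ := G - (1 : Matrix m m ℂ) ⊗ₖ GW with hH
  have hHh : H.IsHermitian := hG.sub (isHermitian_kronecker' Matrix.isHermitian_one hGWh)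
  have hexp : -H + (1 : Matrix m m ℂ) ⊗ₖ cfc Real.log (cfc Real.exp (-GW)) = -G := by
    rw [hlogσ, hH, kronecker_neg_right]; abel
  have hZ' : (Zp - traceLeft (cfc Real.exp (-H + (1 : Matrix m m ℂ) ⊗ₖ cfc Real.log (cfc Real.exp (-GW))))).PosSemidef := by
    rwa [hexp]
  have h := vonNeumannEntropy_sub_traceLeft_sub_le_of_liebCertificate hρ htr hHh hV (fun k => Real.exp_pos _)
    hσV hZ' hcert
  have hρH : (ρ * H).trace.re = (ρ * G).trace.re - (traceLeft ρ * GW).trace.re := by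
    rw [hH, Matrix.mul_sub, Matrix.trace_sub, Complex.sub_re, trace_mul_one_kronecker]
  rw [hρH] at h
  linarith

end Certificate

end Literature.MathematicalPhysics.QuantumLattice

end
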